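import Literature.Analysis.FluidPDE.TsaiLocalEnergy
import Literature.Analysis.FluidPDE.TsaiSelfSimilarPressure
import Literature.Analysis.FluidPDE.ClassicalSuitable
import Literature.Analysis.FluidPDE.TsaiLocalEnergyScaling
import Literature.Analysis.FluidPDE.TsaiProfileL103
import Literature.Analysis.FluidPDE.TsaiLocalEnergyProofs
import Literature.Analysis.FluidPDE.TsaiSelfSimilarPressureProofs
import HarnessLib

/-!
# Tsai 1998, Lemma 4.1 from the weighted-pressure fact: `tsai1998_pressure_L53w → tsai1998_lemma41`

Analysis/FluidPDE proofs-layer file (theorems only) for the named fact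
`Literature.Analysis.FluidPDE.tsai1998_lemma41` of `TsaiLocalEnergy` (T.-P. Tsai, *On Leray's
self-similar solutions of the Navier–Stokes equations satisfying local energy estimates*, Arch.
Rational Mech. Anal. 143 (1998) 29–51, **Lemma 4.1**, p. 46); the sibling `TsaiLocalEnergyProofs`
does the same service for Lemma 4.2. It assembles the decomposition of the fact:

* `TsaiSelfSimilarPressure` — the one deep input, the named fact `tsai1998_pressure_L53w`
  (pp. 45–46: `P̃ = RᵢRⱼ(UᵢUⱼ) ∈ L^{5/3}_w`, `w = |y|^{-5/3} ∈ A_{5/3}`, by the weighted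
  Calderón–Zygmund theory of [St2, pp. 204–211], and `P − P̃ = const` by the argument of
  Lemma 2.1);
* `TsaiLocalEnergyScaling` — the change of variables (4.1) on `Q_ρ(0, T)` (proved);
* `TsaiProfileL103` — (4.3), `∫ |U|^{10/3}|y|^{-5/3} < ∞`, from (4.1) (proved);
* `LeraySelfSimilarCalculus` — `u = λU(λx)`, `p = λ²(P(λx) − c)` solve Navier–Stokes classically
  below the blow-up time (proved);
* `ClassicalSuitable` — `C²` classical solutions are suitable weak solutions, with the classical
  gradient as weak gradient and the local energy equality (proved).

## Main statements

* `tsai1998_lemma41_of_pressure_L53w : tsai1998_pressure_L53w → tsai1998_lemma41`;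
* `tsai_selfsimilar_local_energy_of_pressure_L53w : tsai_selfsimilar → tsai1998_pressure_L53w →
  tsai1998_lemma42 → tsai_selfsimilar_local_energy` (Theorem 2 from Theorem 1, the Calderón–Zygmund
  pressure fact and Lemma 4.2; composition with `tsai_selfsimilar_local_energy_of_lemmas`);
* `tsai_selfsimilar_local_energy_of_pressure_L53w_of_estimates` — the same with Lemma 4.2 replaced
  by the four Caffarelli–Kohn–Nirenberg inputs of `TsaiLocalEnergyProofs`
  (`tsai1998_lemma42_of_estimates`): the **net reduction** of Tsai's Theorem 2 to Theorem 1,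
  the weighted Riesz-transform bound, and the CKN ε-regularity estimates.

* `tsai1998_lemma41_of_weightedRiesz : tsai1998_weightedRieszPressure → tsai1998_lemma41` — with
  the Liouville half of `tsai1998_pressure_L53w` proved in `TsaiSelfSimilarPressureProofs`
  (`tsai1998_pressure_L53w_of_weightedRiesz`), Lemma 4.1 is reduced to the pure
  Calderón–Zygmund statement `tsai1998_weightedRieszPressure` (`TsaiWeightedRieszPressure`:
  `RᵢRⱼ` bounded on `L^{5/3}(|y|^{-5/3}dy)` in PDE form); likewise Theorem 2
  (`tsai_selfsimilar_local_energy_of_weightedRiesz_of_estimates`).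

Once `tsai1998_weightedRieszPressure` is discharged (`_holds`), `tsai1998_lemma41_holds` is
`tsai1998_lemma41_of_weightedRiesz tsai1998_weightedRieszPressure_holds`.

## The proof (Tsai 1998, pp. 44–46)

Given `ν, a, ρ > 0`, a profile `(U, P)` (`IsLerayProfile ν a U P`) and the local energy estimates
for `u = lerayBackward a T U` on `Q_ρ(0, T)`: (4.1)₁ `∫_{B_r}|U|² ≤ (C/ρ) r` for `2ar² > 1`
(`setLIntegral_ball_profile_sq_le`); (4.1)₂ `∫ |∇U|² min(1,|y|⁻¹) < ∞`
(`lintegral_frobeniusNormSq_profile_weight_lt_top`); hence (4.3)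
(`lintegral_rpow_ten_thirds_weight_lt_top`); the fact yields `c` with
`∫ |P − c|^{5/3}|y|^{-5/3} < ∞`; put `p(t,x) = λ(t)²(P(λ(t)x) − c)` (Tsai's `λ²P̃(λx)`,
(1.2)₂); `(u, p)` is a jointly `C²`/`C¹` classical solution on `{t < T} × ℝ³`
(`IsLerayProfile.momentum_lerayBackward`, `isDivFree_lerayBackward`,
`contDiffOn_uncurry_lerayBackward(_Pressure_sub)`), so `isSuitableWeakSolutionOn_of_contDiffOn`
and `hasWeakSpatialGradientOn_of_contDiffOn` give suitability on the cylinder with `G = Dₓu`;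
`∫∫_{Q_ρ}|G|² < ∞` is the hypothesis and `∫∫_{Q_ρ}|p|^{5/3} < ∞` is
`lintegral_selfSimilarPressure_rpow_lt_top` (both after Tonelli,
`setLIntegral_prod_eq_setLIntegral_setLIntegral`).

## References

* T.-P. Tsai, *On Leray's self-similar solutions of the Navier–Stokes equations satisfying local
  energy estimates*, Arch. Rational Mech. Anal. 143 (1998) 29–51: Lemma 4.1 (p. 46) and its
  proof (pp. 44–46); proof of Theorem 2 (p. 47) [Tsai1998].
* L. Caffarelli, R. Kohn, L. Nirenberg, *Partial regularity of suitable weak solutions of the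
  Navier–Stokes equations*, Comm. Pure Appl. Math. 35 (1982), §2 [CaffarelliKohnNirenberg1982].
-/

noncomputable section

open MeasureTheory TopologicalSpace Set Function Filter Topology Metric
open scoped ENNReal NNReal Laplacian InnerProductSpace RealInnerProductSpace

namespace Literature.Analysis.FluidPDE

/-- **Tsai 1998, Lemma 4.1, reduced to the weighted Calderón–Zygmund pressure bound.** The named
fact `tsai1998_lemma41` (`TsaiLocalEnergy`: the self-similar field `u = λ(t)U(λ(t)x)` of a Leray
profile `(U, P)` satisfying the local energy estimates (1.4) on `Q_ρ(0, T)` admits a pressure `p`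
and a weak spatial gradient `G` making `(u, p)` a suitable weak solution on `Q_ρ(0, T)` in
Caffarelli–Kohn–Nirenberg's class, `∫∫ |G|² < ∞`, `p ∈ L^{5/3}(Q_ρ)`) follows from the single
analytic input `tsai1998_pressure_L53w` (`TsaiSelfSimilarPressure`: Tsai 1998, pp. 45–46, the
`A_{5/3}`-weighted `L^{5/3}` bound on `P − c`). The proof is Tsai's (pp. 44–46), every other
step being proved in the tree:

1. (4.1)₁: `sup_t ∫_{B_ρ}|u(t)|² ≤ C` gives `∫_{B_r}|U|² ≤ (C/ρ) r` for `2ar² > 1`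
   (`setLIntegral_ball_profile_sq_le`);
2. (4.1)₂: `∫∫_{Q_ρ}|∇u|² < ∞` gives `∫ |∇U|² min(1, |y|⁻¹) dy < ∞`
   (`lintegral_frobeniusNormSq_profile_weight_lt_top`);
3. (4.3): hence `∫ |U|^{10/3}|y|^{-5/3} dy < ∞` (`lintegral_rpow_ten_thirds_weight_lt_top`, the
   parabolic interpolation `L^∞L² ∩ L²H¹ ⊂ L^{10/3}` on dyadic shells);
4. the fact gives `c` with `∫ |P − c|^{5/3}|y|^{-5/3} dy < ∞`, and the pressure is
   `p(t, x) = λ(t)² (P(λ(t)x) − c)` (Tsai's `λ²P̃(λx)`, (1.2)₂), which lies in `L^{5/3}(Q_ρ(0,T))`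
   (`lintegral_selfSimilarPressure_rpow_lt_top`);
5. `(u, p)` is a `C²`/`C¹` classical solution of Navier–Stokes on `{t < T} × ℝ³`
   (`IsLerayProfile.momentum_lerayBackward`, `isDivFree_lerayBackward`), hence a suitable weak
   solution on the cylinder with weak gradient `G = Dₓu` and the local energy equality
   (`isSuitableWeakSolutionOn_of_contDiffOn`, `hasWeakSpatialGradientOn_of_contDiffOn`); the
   bound `∫∫_{Q_ρ}|G|² < ∞` is the hypothesis (Tonelli).
[cite: Tsai1998, Lemma 4.1 (p. 46) and its proof pp. 44–46] -/
theorem tsai1998_lemma41_of_pressure_L53w (hPw : tsai1998_pressure_L53w) : tsai1998_lemma41 := by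
  intro ν a T ρ hν ha hρ U P hprof henergy hgrad
  have hU2 : ContDiff ℝ 2 U := hprof.contDiff_velocity
  have hU1 : ContDiff ℝ 1 U := hU2.of_le one_le_two
  have hP1 : ContDiff ℝ 1 P := hprof.contDiff_pressure
  -- Step 1: (4.1)₁, linear growth of `∫_{B_r} |U|²`
  obtain ⟨C₀, hC₀⟩ := henergy
  have h2a : 0 < 2 * a := by positivity
  set r₀ : ℝ := (Real.sqrt (2 * a))⁻¹ + 1 with hr₀
  have hE : ∀ r : ℝ, r₀ ≤ r → ∫⁻ y in ball (0 : EuclideanSpace ℝ (Fin 3)) r, ‖U y‖ₑ ^ 2 ≤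
      (C₀ * ENNReal.ofReal ρ⁻¹) * ENNReal.ofReal r := by
    intro r hr
    have hs : 0 < (Real.sqrt (2 * a))⁻¹ := inv_pos.2 (Real.sqrt_pos.2 h2a)
    have hr0 : 0 < r := by rw [hr₀] at hr; linarith
    have hrs : (Real.sqrt (2 * a))⁻¹ < r := by rw [hr₀] at hr; linarith
    have h1 : 1 < 2 * a * r ^ 2 := by
      have hsq : ((Real.sqrt (2 * a))⁻¹) ^ 2 = (2 * a)⁻¹ := by rw [inv_pow, Real.sq_sqrt h2a.le]
      have hlt : (2 * a)⁻¹ < r ^ 2 := by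
        rw [← hsq]; exact pow_lt_pow_left₀ hrs hs.le two_ne_zero
      rw [inv_lt_iff_one_lt_mul₀ h2a] at hlt
      linarith
    calc ∫⁻ y in ball (0 : EuclideanSpace ℝ (Fin 3)) r, ‖U y‖ₑ ^ 2
        ≤ ENNReal.ofReal (r / ρ) * C₀ := setLIntegral_ball_profile_sq_le ha hρ hC₀ hr0 h1
      _ = (C₀ * ENNReal.ofReal ρ⁻¹) * ENNReal.ofReal r := by
          rw [div_eq_inv_mul, ENNReal.ofReal_mul (inv_nonneg.2 hρ.le)]; ring
  -- Step 2: (4.1)₂, the weighted gradient bound; Step 3: (4.3)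
  have hG := lintegral_frobeniusNormSq_profile_weight_lt_top ha hρ hU1 hgrad
  have h43 := lintegral_rpow_ten_thirds_weight_lt_top hU1 (C := C₀ * ENNReal.ofReal ρ⁻¹)
    (ENNReal.mul_ne_top ENNReal.coe_ne_top ENNReal.ofReal_ne_top) hE hG
  -- Step 4: the pressure gauge
  obtain ⟨c, hc⟩ := hPw.exists_sub_const_lt_top hν ha hprof h43
  set p : ℝ → EuclideanSpace ℝ (Fin 3) → ℝ := fun t x => ((Real.sqrt (2 * a * (T - t)))⁻¹) ^ 2 *
    (P ((Real.sqrt (2 * a * (T - t)))⁻¹ • x) - c) with hp_def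
  -- Step 5: classical ⇒ suitable on the cylinder
  have hQ : ((FluidPDE.parabolicCylinderOpens ρ (T, (0 : EuclideanSpace ℝ (Fin 3))) :
      Opens (ℝ × EuclideanSpace ℝ (Fin 3))) : Set (ℝ × EuclideanSpace ℝ (Fin 3))) ⊆ Iio T ×ˢ univ := by
    intro z hz
    rw [FluidPDE.coe_parabolicCylinderOpens, FluidPDE.mem_parabolicCylinder] at hz
    exact ⟨hz.1.2, mem_univ _⟩
  have hu2 : ContDiffOn ℝ 2 (uncurry (lerayBackward a T U)) (Iio T ×ˢ univ) :=
    contDiffOn_uncurry_lerayBackward ha hU2 T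
  have hu1 : ContDiffOn ℝ 1 (uncurry (lerayBackward a T U)) (Iio T ×ˢ univ) := hu2.of_le one_le_two
  have hp1 : ContDiffOn ℝ 1 (uncurry p) (Iio T ×ˢ univ) :=
    contDiffOn_uncurry_lerayBackwardPressure_sub ha hP1 T c
  have hf0 : ContinuousOn (uncurry (0 : ℝ → EuclideanSpace ℝ (Fin 3) → EuclideanSpace ℝ (Fin 3)))
      (Iio T ×ˢ univ) := continuousOn_const
  have hmom : ∀ t ∈ Iio T, ∀ x, timeDeriv (lerayBackward a T U) t x +
      convect (lerayBackward a T U t) (lerayBackward a T U t) x =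
      ν • (Δ (lerayBackward a T U t)) x - gradient (p t) x +
        (0 : ℝ → EuclideanSpace ℝ (Fin 3) → EuclideanSpace ℝ (Fin 3)) t x :=
    fun t ht x => hprof.momentum_lerayBackward ha ht c x
  have hdiv : ∀ t ∈ Iio T, VectorCalculus.IsDivFree (lerayBackward a T U t) :=
    fun t _ => isDivFree_lerayBackward hprof.divFree a T t
  have hsuit := isSuitableWeakSolutionOn_of_contDiffOn isOpen_Iio hQ hu2 hp1 hf0 hmom hdiv
  have hwg := hasWeakSpatialGradientOn_of_contDiffOn isOpen_Iio hQ hu1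
  refine ⟨p, fun t x => fderiv ℝ (lerayBackward a T U t) x, hsuit, hwg, ?_, ?_⟩
  · -- `∫∫_{Q_ρ} |G|² < ∞` is the hypothesis
    have hcont : ContinuousOn (fun z : ℝ × EuclideanSpace ℝ (Fin 3) =>
        ENNReal.ofReal (frobeniusNormSq (fderiv ℝ (lerayBackward a T U z.1) z.2)))
        (Ioo (T - ρ ^ 2) T ×ˢ ball (0 : EuclideanSpace ℝ (Fin 3)) ρ) := by
      have h1 := (continuousOn_fderiv_slice_of_contDiffOn hu1 isOpen_Iio.uniqueDiffOn).mono
        (show Ioo (T - ρ ^ 2) T ×ˢ ball (0 : EuclideanSpace ℝ (Fin 3)) ρ ⊆ Iio T ×ˢ univ from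
          prod_mono (fun t ht => ht.2) (subset_univ _))
      exact ENNReal.continuous_ofReal.comp_continuousOn
        (LerayHopfProofs.continuous_frobeniusNormSq.comp_continuousOn h1)
    change ∫⁻ z in Ioo (T - ρ ^ 2) T ×ˢ ball (0 : EuclideanSpace ℝ (Fin 3)) ρ,
      ENNReal.ofReal (frobeniusNormSq (fderiv ℝ (lerayBackward a T U z.1) z.2)) < ∞
    rw [setLIntegral_prod_eq_setLIntegral_setLIntegral _
      (hcont.aemeasurable (measurableSet_Ioo.prod measurableSet_ball))]
    exact hgrad
  · -- `p ∈ L^{5/3}(Q_ρ)`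
    have hcont : ContinuousOn (fun z : ℝ × EuclideanSpace ℝ (Fin 3) => ‖p z.1 z.2‖ₑ ^ (5 / 3 : ℝ))
        (Ioo (T - ρ ^ 2) T ×ˢ ball (0 : EuclideanSpace ℝ (Fin 3)) ρ) := by
      have h1 : ContinuousOn (fun z : ℝ × EuclideanSpace ℝ (Fin 3) => p z.1 z.2)
          (Ioo (T - ρ ^ 2) T ×ˢ ball (0 : EuclideanSpace ℝ (Fin 3)) ρ) :=
        hp1.continuousOn.mono (prod_mono (fun t ht => ht.2) (subset_univ _))
      exact (ENNReal.continuous_rpow_const.comp continuous_enorm).comp_continuousOn h1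
    change ∫⁻ z in Ioo (T - ρ ^ 2) T ×ˢ ball (0 : EuclideanSpace ℝ (Fin 3)) ρ,
      ‖p z.1 z.2‖ₑ ^ (5 / 3 : ℝ) < ∞
    rw [setLIntegral_prod_eq_setLIntegral_setLIntegral _
      (hcont.aemeasurable (measurableSet_Ioo.prod measurableSet_ball))]
    exact lintegral_selfSimilarPressure_rpow_lt_top ha hρ hP1.continuous.measurable c hc

/-- Hence Tsai's Theorem 2 (`tsai_selfsimilar_local_energy`) follows from Theorem 1
(`tsai_selfsimilar`), the weighted-pressure fact (`tsai1998_pressure_L53w`) and Lemma 4.2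
(`tsai1998_lemma42`): the net reduction of `TsaiLocalEnergy` with Lemma 4.1 discharged down to
its Calderón–Zygmund core (Tsai 1998, proof of Theorem 2, p. 47, "the first way").
[cite: Tsai1998, proof of Theorem 2 (p. 47)] -/
theorem tsai_selfsimilar_local_energy_of_pressure_L53w (h1 : tsai_selfsimilar)
    (hPw : tsai1998_pressure_L53w) (h42 : tsai1998_lemma42) : tsai_selfsimilar_local_energy :=
  tsai_selfsimilar_local_energy_of_lemmas h1 (tsai1998_lemma41_of_pressure_L53w hPw) h42

/-- **The net reduction of Tsai's Theorem 2.** `tsai_selfsimilar_local_energy` follows from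
Theorem 1 (`tsai_selfsimilar`), the weighted Riesz-transform pressure bound
(`tsai1998_pressure_L53w`, the core of Lemma 4.1) and the four Caffarelli–Kohn–Nirenberg inputs
of Lemma 4.2 (`localEnergyEstimate`, `pressureEstimate`, `interpolationEstimate`,
`lemarieRieusset_epsilon_regularity`, through `tsai1998_lemma42_of_estimates` of
`TsaiLocalEnergyProofs`) — Tsai 1998, proof of Theorem 2, p. 47, "the first way".
[cite: Tsai1998, proof of Theorem 2 (p. 47)] -/
theorem tsai_selfsimilar_local_energy_of_pressure_L53w_of_estimates (h1 : tsai_selfsimilar)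
    (hPw : tsai1998_pressure_L53w) (hLE : localEnergyEstimate) (hPE : pressureEstimate)
    (hIE : interpolationEstimate) (hLR : lemarieRieusset_epsilon_regularity) :
    tsai_selfsimilar_local_energy :=
  tsai_selfsimilar_local_energy_of_estimates h1 (tsai1998_lemma41_of_pressure_L53w hPw) hLE hPE hIE
    hLR

/-- **Tsai 1998, Lemma 4.1, reduced to the weighted Riesz-transform bound.** Composing
`tsai1998_lemma41_of_pressure_L53w` with the proved Liouville half of the weighted-pressure fact
(`tsai1998_pressure_L53w_of_weightedRiesz`, `TsaiSelfSimilarPressureProofs`: Weyl's lemma on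
mollifications, the mean-value probes and the `ε`-rescaling estimate of Tsai's Lemma 2.1), the
only unproved input of Lemma 4.1 left is `tsai1998_weightedRieszPressure` — the `A_{5/3}`-weighted
`L^{5/3}` boundedness of `RᵢRⱼ` in PDE form (Tsai 1998, p. 45, "[St2, pp. 204–211]"; Stein 1993,
Ch. V). [cite: Tsai1998, Lemma 4.1 (p. 46) and §4 p. 45] -/
theorem tsai1998_lemma41_of_weightedRiesz (h : tsai1998_weightedRieszPressure) : tsai1998_lemma41 :=
  tsai1998_lemma41_of_pressure_L53w (tsai1998_pressure_L53w_of_weightedRiesz h)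

/-- **Tsai 1998, Theorem 2, reduced to Theorem 1, the weighted Riesz-transform bound and the
Caffarelli–Kohn–Nirenberg estimates** (proof of Theorem 2, p. 47, "the first way": Lemma 4.1 via
`tsai1998_lemma41_of_weightedRiesz`, Lemma 4.2 via `tsai1998_lemma42_of_estimates`).
[cite: Tsai1998, proof of Theorem 2 (p. 47)] -/
theorem tsai_selfsimilar_local_energy_of_weightedRiesz_of_estimates (h1 : tsai_selfsimilar)
    (hR : tsai1998_weightedRieszPressure) (hLE : localEnergyEstimate) (hPE : pressureEstimate)
    (hIE : interpolationEstimate) (hLR : lemarieRieusset_epsilon_regularity) :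
    tsai_selfsimilar_local_energy :=
  tsai_selfsimilar_local_energy_of_estimates h1 (tsai1998_lemma41_of_weightedRiesz hR) hLE hPE hIE
    hLR

end Literature.Analysis.FluidPDE

end
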